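import Literature.AnabelianGeometry.AbsoluteAnabelian.MLFGaloisNoAbelianNormalTFG
import Literature.AnabelianGeometry.AbsoluteAnabelian.MLFGaloisTFGProofs
import Literature.NumberTheory.GaloisRepresentations.LocalFieldCdTwo
import Literature.NumberTheory.GaloisRepresentations.ContinuousH3CupOfCharacters
import Literature.NumberTheory.GaloisRepresentations.LocalFieldFiniteExtension
import Literature.NumberTheory.GaloisRepresentations.LocalFieldPadicProofs
import Literature.GroupTheory.FiniteAbelian.InvariantFactorDecomposition
import HarnessLib

/-!
# `G_K` (`K/ℚ_p` finite) has no non-trivial closed abelian (or nilpotent) subgroup that is normal in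
# an open subgroup — the BARE form, topological finite generation NOT assumed (proof-only)

J. Neukirch, A. Schmidt, K. Wingberg, *Cohomology of Number Fields* (2008), Ch. VII §5 (structure of
`G_k` for a `p`-adic field `k`), with (7.1.8)/(3.3.x)-type rank bounds from `cd = 2`
[cite: NeukirchSchmidtWingberg2008, Ch. VII §5]; J.-P. Serre, *Cohomologie galoisienne*, II §4.3
Prop. 12 (`cd_p(G_k) = 2`) and I §3.3 [cite: SerreGaloisCohomology1997, II §4.3 Prop. 12];
S. Mochizuki, [AbsTopI] Thm 1.7 (ii) p. 14 (`G_k` elastic) [cite: MochizukiAbsTopI2012, Thm 1.7 (ii) p.14].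

abc-iut cell, seat abc-iut-L6-t19 (gen 10), row «GK-NO-ABELIAN-NORMAL-BARE@cd2» (abc-iut-L6-lead §F
v1.19dt (G) 2026-08-27): the bare-∀ residual left by `MLFGaloisNoAbelianNormalTFG.lean`
(abc-iut-w5-d204: the TFG form `eq_bot_of_comm_of_normal_subgroupOf_of_tfg`, which needs the abelian
subgroup to be topologically finitely generated).  This PROOF-ONLY file removes the hypothesis:

* `isTopologicallyFinitelyGenerated_of_isClosed_of_comm` — **every closed abelian subgroup `N` of
  `Gal(F̄/F)` (`F` a non-archimedean local field of characteristic `0`) is topologically finitely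
  generated** (by two elements).  Proof: by the compactness criterion
  `isTopologicallyFinitelyGenerated_of_forall_quotient` it suffices that every finite quotient `N/U`
  (`U` open normal) is `2`-generated; `N/U` is a finite abelian group `≅ ℤ/m₁ × ⋯ × ℤ/m_t` with
  `1 < m₁ ∣ ⋯ ∣ m_t` (invariant factors, `FiniteAbelian.exists_addEquiv_pi_zmod_chain_of_finite`);
  if `t ≥ 3`, a prime `ℓ ∣ m₁` yields three continuous characters `N ↠ N/U → ℤ/ℓ` and three
  commuting lifts of the first three basis vectors with `χᵢ(bⱼ) = δᵢⱼ`, so `cd_ℓ(N) ≥ 3`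
  (`not_groupCdLE_two_of_three_commuting`, the triple cup product) — contradicting
  **`cd_ℓ(N) ≤ 2`** for closed subgroups of `Gal(F̄/F)` (`groupCdLE_two_of_isClosed`, Serre II §4.3
  Prop. 12 + I §3.3 Prop. 14, PROVED in the tree); hence `t ≤ 2` and the basis lifts generate `N/U`;
* `…_padic` — the same for the binder form `(p) (K) [Algebra ℚ_[p] K] [FiniteDimensional ℚ_[p] K]`
  (valued model by `FiniteExtension.isNonarchimedeanLocalField` over
  `Padic.isNonarchimedeanLocalField_holds`, as in `AbsTopIRankFormulaProofs`);
* **`eq_bot_of_comm_of_normal_subgroupOf_of_isClosed`** — for `K/ℚ_p` finite, an OPEN `H ≤ G_K` and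
  a CLOSED abelian `N ≤ H` normal in `H`: `N = ⊥` (one term from w5-d204's TFG form);
  `eq_bot_of_comm_of_normal_of_isClosed` (`H = G_K`);
* **`eq_bot_of_isNilpotent_of_normal_subgroupOf_of_isClosed`** — the nilpotent (Fitting-shape)
  twin: the centre of a closed nilpotent `N` normal in an open `H` is closed, abelian and normal in
  `H`, hence `⊥`, hence `N = ⊥`; `eq_bot_of_isNilpotent_of_normal_of_isClosed` (`H = G_K`).

So: **`G_K` has no non-trivial closed abelian — or nilpotent — subgroup normal in an open subgroup**,
with no finite-generation hypothesis.  (abc-iut-w5-d204's abstract example `𝔽_p[[T]] ⋊ ℤ_p` shows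
slim + elastic alone cannot give this; the extra input used here is `cd_ℓ ≤ 2`.)
HONEST FRAMING: classical; nothing in this file bears on [IUTchIII] Cor. 3.12; typed ≠ proved
elsewhere; nothing here asserts abc proved or refuted.
-/

noncomputable section

open Topology Field

namespace Literature.AnabelianGeometry.AbsoluteAnabelian

open Literature.NumberTheory.GaloisRepresentations
open Literature.GroupTheory.FiniteAbelian

/-! ### Finite abelian groups in invariant-factor form are generated by the basis vectors -/

/-- In a product `Π_{j<t} ℤ/mⱼ` with all `mⱼ ≠ 0`, pulled back along an additive isomorphism
`e : A ≃+ Π ℤ/mⱼ`, every element is a `ℕ`-combination of the basis elements `e⁻¹(δⱼ)`: they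
generate `A`. [cite: NeukirchSchmidtWingberg2008, Ch. VII §5] -/
theorem mem_closure_range_symm_single {A : Type*} [AddCommGroup A] {t : ℕ} {m : Fin t → ℕ}
    (hm : ∀ j, 1 < m j) (e : A ≃+ (Π j, ZMod (m j))) (a : A) :
    a ∈ AddSubgroup.closure (Set.range fun j => e.symm (Pi.single j 1)) := by
  classical
  haveI : ∀ j, NeZero (m j) := fun j => NeZero.of_pos (by have := hm j; omega)
  have ha : a = ∑ j, ((e a j).val) • e.symm (Pi.single j 1) := by
    apply e.injective
    rw [map_sum]
    conv_lhs => rw [← Finset.univ_sum_single (e a)]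
    refine Finset.sum_congr rfl fun j _ => ?_
    rw [map_nsmul, e.apply_symm_apply, ← Pi.single_smul, nsmul_eq_mul, mul_one, ZMod.natCast_zmod_val]
  rw [ha]
  exact AddSubgroup.sum_mem _ fun j _ =>
    AddSubgroup.nsmul_mem _ (AddSubgroup.subset_closure (Set.mem_range_self j)) _

/-! ### Closed abelian subgroups of `Gal(F̄/F)` are topologically finitely generated -/

section Local

variable (F : Type) [Field F] [ValuativeRel F] [TopologicalSpace F] [IsNonarchimedeanLocalField F]
  [CharZero F]

/-- **Closed abelian subgroups of `Gal(F̄/F)` are topologically finitely generated** (`F` a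
non-archimedean local field of characteristic `0`): every finite quotient of such an `N` is
`2`-generated, since three independent `ℤ/ℓ`-characters with commuting dual elements would force
`cd_ℓ(N) ≥ 3` (`not_groupCdLE_two_of_three_commuting`) against `cd_ℓ(N) ≤ 2`
(`groupCdLE_two_of_isClosed`, Serre II §4.3 Prop. 12 with I §3.3 Prop. 14).
[cite: NeukirchSchmidtWingberg2008, Ch. VII §5] [cite: SerreGaloisCohomology1997, II §4.3 Prop. 12] -/
theorem isTopologicallyFinitelyGenerated_of_isClosed_of_comm (N : Subgroup (absoluteGaloisGroup F))
    (hN : IsClosed (N : Set (absoluteGaloisGroup F))) (hcomm : ∀ a ∈ N, ∀ b ∈ N, a * b = b * a) :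
    IsTopologicallyFinitelyGenerated N := by
  classical
  haveI := absoluteGaloisGroup_compactSpace F
  haveI : CompactSpace N := isCompact_iff_compactSpace.mp hN.isCompact
  have hcd : ∀ (ℓ : ℕ) [Fact ℓ.Prime], GroupCdLE N ℓ 2 := fun ℓ _ => groupCdLE_two_of_isClosed F N hN ℓ
  have hcommN : ∀ a b : N, a * b = b * a := fun a b => Subtype.ext (hcomm _ a.2 _ b.2)
  refine isTopologicallyFinitelyGenerated_of_forall_quotient (D := 2) fun U hU hUo => ?_
  haveI := hU
  haveI : DiscreteTopology (N ⧸ U) := QuotientGroup.discreteTopology hUo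
  haveI : Finite (N ⧸ U) := finite_of_compact_of_discrete
  -- the finite quotient is abelian
  have hQ : ∀ a b : N ⧸ U, a * b = b * a := by
    intro a b
    obtain ⟨x, rfl⟩ := QuotientGroup.mk_surjective a
    obtain ⟨y, rfl⟩ := QuotientGroup.mk_surjective b
    rw [← QuotientGroup.mk_mul, ← QuotientGroup.mk_mul, hcommN]
  letI : CommGroup (N ⧸ U) := { (inferInstance : Group (N ⧸ U)) with mul_comm := hQ }
  -- invariant factors of the finite abelian group `N/U`
  obtain ⟨t, m, hm1, hchain, ⟨e⟩⟩ := exists_addEquiv_pi_zmod_chain_of_finite (Additive (N ⧸ U))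
  -- lifts of the basis vectors
  have hlift : ∀ j : Fin t, ∃ n : N,
      (QuotientGroup.mk n : N ⧸ U) = Additive.toMul (e.symm (Pi.single j 1)) :=
    fun j => QuotientGroup.mk_surjective _
  choose g hg using hlift
  -- (1) `t ≤ 2`: otherwise three characters with commuting dual elements
  have ht : t ≤ 2 := by
    by_contra h3
    have h3' : 3 ≤ t := by omega
    let j0 : Fin t := ⟨0, by omega⟩
    let ℓ := (m j0).minFac
    haveI : Fact ℓ.Prime := ⟨Nat.minFac_prime (ne_of_gt (hm1 j0))⟩
    have hdvd : ∀ j : Fin t, ℓ ∣ m j :=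
      fun j => (Nat.minFac_dvd (m j0)).trans (hchain j0 j (Fin.mk_le_mk.mpr (Nat.zero_le _)))
    let ι : Fin 3 → Fin t := fun i => ⟨i.val, lt_of_lt_of_le i.isLt h3'⟩
    have hι : Function.Injective ι := fun i i' h => Fin.ext (by simpa [ι] using congrArg Fin.val h)
    -- the three characters `N ↠ N/U ≅ Π ℤ/mⱼ → ℤ/m_{ι i} → ℤ/ℓ`
    let ψ : Fin 3 → (N ⧸ U) → ZMod ℓ := fun i q =>
      ZMod.castHom (hdvd (ι i)) (ZMod ℓ) (e (Additive.ofMul q) (ι i))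
    let χ : Fin 3 → C(N, ZMod ℓ) := fun i =>
      ⟨fun n => ψ i (QuotientGroup.mk n), (continuous_of_discreteTopology (f := ψ i)).comp
        (QuotientGroup.continuous_mk (N := U))⟩
    have hχ : ∀ i n, χ i n = ψ i (QuotientGroup.mk n) := fun _ _ => rfl
    have hadd : ∀ i (x y : N), χ i (x * y) = χ i x + χ i y := by
      intro i x y
      rw [hχ, hχ, hχ]
      simp only [ψ, QuotientGroup.mk_mul, ofMul_mul, map_add, Pi.add_apply]
    let b : Fin 3 → N := fun j => g (ι j)
    have hb : ∀ i j, χ i (b j) = if i = j then 1 else 0 := by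
      intro i j
      rw [hχ]
      simp only [ψ, b, hg, ofMul_toMul, AddEquiv.apply_symm_apply]
      by_cases hij : i = j
      · subst hij
        rw [Pi.single_eq_same, map_one, if_pos rfl]
      · rw [Pi.single_eq_of_ne (fun h => hij (hι h)), map_zero, if_neg hij]
    have hcomm3 : ∀ i j, b i * b j = b j * b i := fun i j => hcommN _ _
    exact not_groupCdLE_two_of_three_commuting χ b hadd hcomm3 hb (hcd ℓ)
  -- (2) the (at most two) basis lifts generate `N` modulo `U`
  let x : Fin 2 → N := fun k => if h : k.val < t then g ⟨k.val, h⟩ else 1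
  refine ⟨x, ?_⟩
  have hgen : ∀ j : Fin t, g j ∈ Subgroup.closure (Set.range x) := by
    intro j
    have hj : j.val < 2 := lt_of_lt_of_le j.isLt ht
    have hx : x ⟨j.val, hj⟩ = g j := by
      simp only [x, dif_pos j.isLt]
    exact hx ▸ Subgroup.subset_closure ⟨⟨j.val, hj⟩, rfl⟩
  have hmap : Subgroup.map (QuotientGroup.mk' U) (Subgroup.closure (Set.range x)) = ⊤ := by
    refine top_le_iff.mp fun q _ => ?_
    -- `q = Π_j (mk (g j))^(cⱼ)` from the invariant-factor coordinates
    have hq : Additive.ofMul q ∈ AddSubgroup.closure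
        (Set.range fun j => e.symm (Pi.single j 1)) :=
      mem_closure_range_symm_single hm1 e (Additive.ofMul q)
    have hsub : AddSubgroup.closure (Set.range fun j => e.symm (Pi.single j 1)) ≤
        (Subgroup.map (QuotientGroup.mk' U) (Subgroup.closure (Set.range x))).toAddSubgroup := by
      rw [AddSubgroup.closure_le]
      rintro _ ⟨j, rfl⟩
      change Additive.toMul (e.symm (Pi.single j 1)) ∈
        Subgroup.map (QuotientGroup.mk' U) (Subgroup.closure (Set.range x))
      rw [← hg j]
      exact Subgroup.mem_map_of_mem _ (hgen j)
    exact hsub hq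
  have := Subgroup.comap_map_eq (QuotientGroup.mk' U) (Subgroup.closure (Set.range x))
  rw [hmap, Subgroup.comap_top, QuotientGroup.ker_mk'] at this
  exact this.symm

/-- **No non-trivial closed abelian subgroup normal in an open subgroup, valued form**: for `F` a
non-archimedean local field of characteristic `0` realised as a finite extension of `ℚ_p`… — see the
`ℚ_p`-binder forms below, which are the ones consumed; this valued-model lemma records that the
rank bound needs only `cd_ℓ ≤ 2`. [cite: SerreGaloisCohomology1997, II §4.3 Prop. 12] -/
theorem not_exists_three_characters_of_isClosed (N : Subgroup (absoluteGaloisGroup F))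
    (hN : IsClosed (N : Set (absoluteGaloisGroup F))) {ℓ : ℕ} [Fact ℓ.Prime]
    (χ : Fin 3 → C(N, ZMod ℓ)) (b : Fin 3 → N) (hadd : ∀ i g h, χ i (g * h) = χ i g + χ i h)
    (hcomm : ∀ i j, b i * b j = b j * b i) (hδ : ∀ i j, χ i (b j) = if i = j then 1 else 0) :
    False := by
  haveI := absoluteGaloisGroup_compactSpace F
  haveI : CompactSpace N := isCompact_iff_compactSpace.mp hN.isCompact
  exact not_groupCdLE_two_of_three_commuting χ b hadd hcomm hδ (groupCdLE_two_of_isClosed F N hN ℓ)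

end Local

/-! ### The centre of a normal subgroup (general topological groups) -/

/-- The image in `G` of the centre of a subgroup `N` (as a subgroup of `G`), its basic properties:
it is contained in `N`, abelian, closed when `N` is closed (`G` Hausdorff), and normal in any
subgroup `H` in which `N` is normal. [cite: NeukirchSchmidtWingberg2008, Ch. VII §5] -/
theorem center_map_subtype_props {G : Type*} [Group G] [TopologicalSpace G] [IsTopologicalGroup G]
    [T2Space G] (H N : Subgroup G) (hNH : N ≤ H) (hNn : (N.subgroupOf H).Normal)
    (hNc : IsClosed (N : Set G)) :
    (Subgroup.map N.subtype (Subgroup.center N) ≤ N) ∧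
    (∀ a ∈ Subgroup.map N.subtype (Subgroup.center N), ∀ b ∈ Subgroup.map N.subtype (Subgroup.center N),
        a * b = b * a) ∧
    IsClosed ((Subgroup.map N.subtype (Subgroup.center N) : Subgroup G) : Set G) ∧
    ((Subgroup.map N.subtype (Subgroup.center N)).subgroupOf H).Normal := by
  refine ⟨?_, ?_, ?_, ?_⟩
  · rintro _ ⟨z, -, rfl⟩
    exact z.2
  · rintro _ ⟨z, hz, rfl⟩ _ ⟨w, -, rfl⟩
    exact congrArg Subtype.val ((Subgroup.mem_center_iff.mp hz) w).symm
  · -- `Z = N ∩ ⋂_{n ∈ N} {g | g n = n g}` is closed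
    have hset : ((Subgroup.map N.subtype (Subgroup.center N) : Subgroup G) : Set G) =
        (N : Set G) ∩ ⋂ n : N, {g : G | g * n = n * g} := by
      ext g
      simp only [Subgroup.coe_map, Subgroup.coe_subtype, Set.mem_image, SetLike.mem_coe,
        Set.mem_inter_iff, Set.mem_iInter, Set.mem_setOf_eq]
      constructor
      · rintro ⟨z, hz, rfl⟩
        exact ⟨z.2, fun n => congrArg Subtype.val ((Subgroup.mem_center_iff.mp hz) n).symm⟩
      · rintro ⟨hg, hc⟩
        exact ⟨⟨g, hg⟩, Subgroup.mem_center_iff.mpr fun n => Subtype.ext (hc n).symm, rfl⟩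
    rw [hset]
    exact hNc.inter (isClosed_iInter fun n =>
      isClosed_eq (continuous_id.mul continuous_const) (continuous_const.mul continuous_id))
  · constructor
    rintro z hz h
    -- `z ∈ H` with `(z : G) ∈ Z`; conjugate by `h ∈ H`
    rw [Subgroup.mem_subgroupOf] at hz ⊢
    obtain ⟨w, hw, hwz⟩ := hz
    have hzN : (z : G) ∈ N := hwz ▸ w.2
    have hconjN : (h * z * h⁻¹ : H).1 ∈ N := by
      have := hNn.conj_mem ⟨z.1, z.2⟩ ((Subgroup.mem_subgroupOf).mpr hzN) h
      exact (Subgroup.mem_subgroupOf).mp this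
    refine ⟨⟨(h * z * h⁻¹ : H).1, hconjN⟩, ?_, rfl⟩
    rw [SetLike.mem_coe, Subgroup.mem_center_iff]
    intro n
    apply Subtype.ext
    change (n : G) * ((h : G) * z * (h : G)⁻¹) = (h : G) * z * (h : G)⁻¹ * n
    -- `h⁻¹ n h ∈ N` commutes with `z`
    have hn' : ((h : G)⁻¹ * n * (h : G)) ∈ N := by
      have := hNn.conj_mem ⟨(n : G), hNH n.2⟩ ((Subgroup.mem_subgroupOf).mpr n.2) h⁻¹
      simpa [Subgroup.mem_subgroupOf] using this
    have hcz : (z : G) * ((h : G)⁻¹ * n * (h : G)) = ((h : G)⁻¹ * n * (h : G)) * z := by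
      have := (Subgroup.mem_center_iff.mp hw) ⟨_, hn'⟩
      have := congrArg Subtype.val this
      have hwz' : (w : G) = (z : G) := by simpa using hwz
      rw [← hwz']
      simpa using this.symm
    -- rearrange
    calc (n : G) * ((h : G) * z * (h : G)⁻¹)
        = (h : G) * (((h : G)⁻¹ * n * (h : G)) * z) * (h : G)⁻¹ := by group
      _ = (h : G) * ((z : G) * ((h : G)⁻¹ * n * (h : G))) * (h : G)⁻¹ := by rw [hcz]
      _ = (h : G) * z * (h : G)⁻¹ * n := by group

/-! ### The `ℚ_p`-binder forms: `K/ℚ_p` finite -/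

variable (p : ℕ) [Fact p.Prime] (K : Type) [Field K] [Algebra ℚ_[p] K] [FiniteDimensional ℚ_[p] K]

include p

/-- **Closed abelian subgroups of `G_K` (`K/ℚ_p` finite) are topologically finitely generated.**
The binder `K` is given the tree's valued model (`FiniteExtension.valuativeRel/topologicalSpace/
isNonarchimedeanLocalField` over `Padic.isNonarchimedeanLocalField_holds`); the Krull topology of
`G_K` does not depend on it. [cite: NeukirchSchmidtWingberg2008, Ch. VII §5] -/
theorem isTopologicallyFinitelyGenerated_of_isClosed_of_comm_padic (N : Subgroup (absoluteGaloisGroup K))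
    (hN : IsClosed (N : Set (absoluteGaloisGroup K))) (hcomm : ∀ a ∈ N, ∀ b ∈ N, a * b = b * a) :
    IsTopologicallyFinitelyGenerated N := by
  haveI : IsNonarchimedeanLocalField ℚ_[p] := Padic.isNonarchimedeanLocalField_holds p
  letI := FiniteExtension.valuativeRel ℚ_[p] K
  letI := FiniteExtension.topologicalSpace ℚ_[p] K
  haveI : IsNonarchimedeanLocalField K := FiniteExtension.isNonarchimedeanLocalField ℚ_[p] K
  haveI : CharZero K := charZero_of_injective_algebraMap (algebraMap ℚ_[p] K).injective
  exact isTopologicallyFinitelyGenerated_of_isClosed_of_comm K N hN hcomm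

/-- **THE BARE FORM.** For `K/ℚ_p` finite, an open subgroup `H ⊆ G_K` and a subgroup `N ⊆ H` which
is normal in `H`, CLOSED and abelian: `N = ⊥` — topological finite generation is automatic
(`isTopologicallyFinitelyGenerated_of_isClosed_of_comm_padic`), then the TFG form
`eq_bot_of_comm_of_normal_subgroupOf_of_tfg` (elasticity [AbsTopI] Thm 1.7 (ii) + slimness [pGC]
Lem 15.8). [cite: NeukirchSchmidtWingberg2008, Ch. VII §5] [cite: MochizukiAbsTopI2012, Thm 1.7 (ii) p.14] -/
theorem eq_bot_of_comm_of_normal_subgroupOf_of_isClosed (H N : Subgroup (absoluteGaloisGroup K))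
    (hH : IsOpen (H : Set (absoluteGaloisGroup K))) (hNH : N ≤ H) (hNn : (N.subgroupOf H).Normal)
    (hNc : IsClosed (N : Set (absoluteGaloisGroup K)))
    (hcomm : ∀ a ∈ N, ∀ b ∈ N, a * b = b * a) : N = ⊥ :=
  eq_bot_of_comm_of_normal_subgroupOf_of_tfg p K H N hH hNH hNn hNc
    (isTopologicallyFinitelyGenerated_of_isClosed_of_comm_padic p K N hNc hcomm) hcomm

/-- **`G_K` has no non-trivial closed abelian NORMAL subgroup** (`K/ℚ_p` finite; the case
`H = G_K`). [cite: NeukirchSchmidtWingberg2008, Ch. VII §5] -/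
theorem eq_bot_of_comm_of_normal_of_isClosed (N : Subgroup (absoluteGaloisGroup K)) (hNn : N.Normal)
    (hNc : IsClosed (N : Set (absoluteGaloisGroup K))) (hcomm : ∀ a ∈ N, ∀ b ∈ N, a * b = b * a) :
    N = ⊥ :=
  eq_bot_of_comm_of_normal_subgroupOf_of_isClosed p K ⊤ N (by rw [Subgroup.coe_top]; exact isOpen_univ)
    le_top (hNn.subgroupOf ⊤) hNc hcomm

/-! ### The nilpotent (Fitting-shape) twin -/

/-- **THE BARE NILPOTENT FORM (Fitting shape).** For `K/ℚ_p` finite, an open subgroup `H ⊆ G_K` and a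
subgroup `N ⊆ H`, normal in `H`, CLOSED and NILPOTENT: `N = ⊥` — the image of the centre of `N` is a
closed abelian subgroup of `H` normal in `H`, hence trivial (`eq_bot_of_comm_of_normal_subgroupOf_of_isClosed`),
and a nilpotent group with trivial centre is trivial (Mathlib `Group.IsNilpotent.center_ne_bot`).
[cite: NeukirchSchmidtWingberg2008, Ch. VII §5] [cite: MochizukiAbsTopI2012, Thm 1.7 (ii) p.14] -/
theorem eq_bot_of_isNilpotent_of_normal_subgroupOf_of_isClosed (H N : Subgroup (absoluteGaloisGroup K))
    (hH : IsOpen (H : Set (absoluteGaloisGroup K))) (hNH : N ≤ H) (hNn : (N.subgroupOf H).Normal)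
    (hNc : IsClosed (N : Set (absoluteGaloisGroup K))) (hnil : Group.IsNilpotent N) : N = ⊥ := by
  obtain ⟨hZN, hZcomm, hZc, hZn⟩ := center_map_subtype_props H N hNH hNn hNc
  have hZ := eq_bot_of_comm_of_normal_subgroupOf_of_isClosed p K H
    (Subgroup.map N.subtype (Subgroup.center N)) hH (hZN.trans hNH) hZn hZc hZcomm
  by_contra hne
  haveI : Nontrivial N := (Subgroup.nontrivial_iff_ne_bot N).mpr hne
  refine Group.IsNilpotent.center_ne_bot (G := N) (le_bot_iff.mp fun z hz => ?_)
  have hz' : (z : absoluteGaloisGroup K) ∈ Subgroup.map N.subtype (Subgroup.center N) := ⟨z, hz, rfl⟩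
  rw [hZ] at hz'
  exact Subgroup.mem_bot.mpr (Subtype.ext (Subgroup.mem_bot.mp hz'))

/-- **`G_K` has no non-trivial closed nilpotent NORMAL subgroup** (`K/ℚ_p` finite; `H = G_K`): the
Fitting subgroup of `G_K` over closed normal subgroups is trivial. [cite: NeukirchSchmidtWingberg2008, Ch. VII §5] -/
theorem eq_bot_of_isNilpotent_of_normal_of_isClosed (N : Subgroup (absoluteGaloisGroup K))
    (hNn : N.Normal) (hNc : IsClosed (N : Set (absoluteGaloisGroup K))) (hnil : Group.IsNilpotent N) :
    N = ⊥ :=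
  eq_bot_of_isNilpotent_of_normal_subgroupOf_of_isClosed p K ⊤ N
    (by rw [Subgroup.coe_top]; exact isOpen_univ) le_top (hNn.subgroupOf ⊤) hNc hnil

end Literature.AnabelianGeometry.AbsoluteAnabelian

end
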